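import Literature.Topology.FourManifolds.HandleAttachingMaps
import Literature.Topology.FourManifolds.ClosedBallSmoothMaps
import Literature.Topology.FourManifolds.CorkDecompositionSplittingProof
import Mathlib.Analysis.SpecialFunctions.Sqrt
import Mathlib.Analysis.InnerProductSpace.Calculus
import HarnessLib

/-!
# Kosinski's inversion `α` as a partial diffeomorphism `Dᵐ ∖ S ⇀ T`; immersion plumbing

Topic `Literature/Topology/FourManifolds`; infrastructure below `HandleAttachingMaps.lean` for
the locality of handle attachments (`HandleAttachingMapsLocality.lean`: the attachment
`M ∪ H^λ` only depends on the attaching map `h̄ : T → M` near the attaching sphere `S`), itself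
a step of the isotopy invariance of handle attachment (Kosinski, *Differential Manifolds*
(1993), VI §6 with VIII, proof of (1.2); the tree's named fact
`Literature.Geometry.Symplectic.HandleAttachingMap.isMultiAttachment_of_linkIsotopyInBoundary`).
There, a new handle embedding `Dᵐ ∖ S → P` is assembled from the old one near the belt disc and
from `jA ∘ h̄' ∘ α` on `T ∖ S`, and one must know that the latter is an immersion.  This file
supplies:

* **smoothness of `α`** (Kosinski VI (6.1), `handleInversion`) on the open set
  `{0 < |x_λ|² < 1}` of `ℝᵐ` (`contDiffAt_handleInversion`), and `α` as an open partial
  homeomorphism `handleInversionPH n k : Dᵐ ∖ S ⇀ T` with source `{x_λ ≠ 0}`, target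
  `{|x_λ| ≠ 1}`, inverse `α`, `C^∞` in both directions for the structures with boundary
  (`contMDiffOn_handleInversionPH`, `contMDiffOn_handleInversionPH_symm`);
* two conveniences on top of the tree's immersion plumbing
  (`CorkDecompositionSplittingProof.lean`, §2: `openPartialHomeomorph_comp`, `codRestrict_opens`,
  `of_finrank_eq`, `openEmbeddingChart`): post-composition of an immersion with an *open smooth
  embedding* between manifolds on the same model
  (`Manifold.IsImmersionAtOfComplement.openEmbedding_comp`), and, for equidimensional maps, the
  passage from pointwise to global immersions (`Manifold.isImmersion_of_isImmersionAt_of_finrank_eq`: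
  Mathlib's `IsImmersion` fixes one complement for all points; equidimensionally every
  complement is trivial).

Everything is proved; no named facts.

## References

* A. A. Kosinski, *Differential Manifolds*, Academic Press (1993), VI §6, (6.1). [Kosinski1993]
* J. M. Lee, *Introduction to Smooth Manifolds* (2013), Ch. 4–5 (immersions, embeddings, open
  submanifolds). [LeeSmoothManifolds2013]
-/

open scoped Manifold ContDiff Topology
open Set Function Metric

noncomputable section

/-! ### Immersion plumbing (Mathlib gaps; deliberate extensions of the `Manifold` namespace) -/

namespace Manifold

universe u

variable {E : Type*} {E' : Type u} {F : Type*} [NormedAddCommGroup E] [NormedSpace ℝ E]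
  [NormedAddCommGroup E'] [NormedSpace ℝ E'] [NormedAddCommGroup F] [NormedSpace ℝ F]
  {H : Type*} [TopologicalSpace H] {G : Type*} [TopologicalSpace G]
  {I : ModelWithCorners ℝ E H} {J : ModelWithCorners ℝ E' G}
  {M : Type*} [TopologicalSpace M] [ChartedSpace H M]
  {N : Type*} [TopologicalSpace N] [ChartedSpace G N]
  {N' : Type*} [TopologicalSpace N'] [ChartedSpace G N']
  {n : ℕ∞ω} {f : M → N}

/-- **Post-composition of an immersion (chosen complement) with an open smooth embedding.**
If `f` is an immersion at `x` and `e : N → N'` is a `C^∞` embedding with open range between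
manifolds on the same model, then `e ∘ f` is an immersion at `x` (the tree's
`openPartialHomeomorph_comp` applied to the partial diffeomorphism `openEmbeddingChart` of `e`).
Special case of the composition of immersions; Lee (2013), Ch. 4–5. Deliberate dot-notation
extension of Mathlib's `Manifold` namespace. [folklore] -/
theorem IsImmersionAtOfComplement.openEmbedding_comp [IsManifold I ∞ M] [IsManifold J ∞ N']
    {x : M} (h : IsImmersionAtOfComplement F I J ∞ f x) {e : N → N'}
    (he : IsSmoothEmbedding J J ∞ e) (heo : IsOpen (range e)) :
    IsImmersionAtOfComplement F I J ∞ (e ∘ f) x := by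
  haveI : Nonempty N := ⟨f x⟩
  exact h.openPartialHomeomorph_comp (Literature.Topology.FourManifolds.openEmbeddingChart he heo)
    (Literature.Topology.FourManifolds.contMDiffOn_openEmbeddingChart he heo)
    (Literature.Topology.FourManifolds.contMDiffOn_openEmbeddingChart_symm he heo) (by simp)

/-- **Pointwise immersions are immersions, equidimensionally.**  Mathlib's global `IsImmersion`
fixes one complement for all points; when the model vector spaces have the same finite
dimension every pointwise complement is trivial (the tree's
`IsImmersionAtOfComplement.of_finrank_eq` with `F₀ = Unit`), so a map which is an immersion at
every point is an immersion. Deliberate extension of the `Manifold` namespace. [folklore] -/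
theorem isImmersion_of_isImmersionAt_of_finrank_eq [FiniteDimensional ℝ E]
    [FiniteDimensional ℝ E'] (hE : Module.finrank ℝ E = Module.finrank ℝ E')
    (h : ∀ x, IsImmersionAt I J ∞ f x) : IsImmersion I J ∞ f :=
  IsImmersionOfComplement.isImmersion (F := Unit) fun x =>
    (h x).isImmersionAtOfComplement_complement.of_finrank_eq (F₀ := Unit)
      (by rw [Module.finrank_zero_of_subsingleton (M := Unit), add_zero]; exact hE)

end Manifold

/-! ### Kosinski's inversion `α` is smooth off the belt disc and the attaching sphere -/

namespace Literature.Topology.FourManifolds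

/-- Local notation: `𝔼 n` is the model Euclidean space `EuclideanSpace ℝ (Fin n)`. -/
local notation "𝔼 " n:arg => EuclideanSpace ℝ (Fin n)

/-- Local notation: `𝔻 n` is the closed unit ball in `EuclideanSpace ℝ (Fin n)`. -/
local notation "𝔻 " n:arg => (Metric.closedBall (0 : EuclideanSpace ℝ (Fin n)) 1)

section Model

variable {m : ℕ}

/-- `|x_λ|²` is a smooth function on `ℝᵐ` (a sum of squares of coordinates). [folklore] -/
theorem contDiff_lamSq (k : ℕ) : ContDiff ℝ ∞ (lamSq (m := m) k) := by
  unfold lamSq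
  refine ContDiff.sum fun i _ => ?_
  exact (contDiff_piLp_apply (p := 2) (E := fun _ : Fin m => ℝ) (𝕜 := ℝ) (n := ∞) (i := i)).pow 2

/-- **`α` is `C^∞` at every point with `0 < |x_λ|² < 1`** (formula (6.1): the coordinates of
`x` times smooth functions of `|x_λ|²` built from `√` away from `0`).
[cite: Kosinski1993, VI (6.1)] -/
theorem contDiffAt_handleInversion {k : ℕ} {u : 𝔼 m} (h0 : 0 < lamSq k u) (h1 : lamSq k u < 1) :
    ContDiffAt ℝ ∞ (handleInversion (m := m) k) u := by
  have hl : ContDiffAt ℝ ∞ (lamSq (m := m) k) u := (contDiff_lamSq k).contDiffAt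
  have hs1 : ContDiffAt ℝ ∞ (fun v : 𝔼 m => Real.sqrt (lamSq k v)) u :=
    hl.sqrt h0.ne'
  have hs2 : ContDiffAt ℝ ∞ (fun v : 𝔼 m => Real.sqrt (1 - lamSq k v)) u :=
    (contDiffAt_const.sub hl).sqrt (sub_pos.2 h1).ne'
  have hne1 : Real.sqrt (lamSq k u) ≠ 0 := Real.sqrt_ne_zero'.2 h0
  have hne2 : Real.sqrt (1 - lamSq k u) ≠ 0 := Real.sqrt_ne_zero'.2 (sub_pos.2 h1)
  rw [contDiffAt_euclidean]
  intro i
  have hc : ContDiffAt ℝ ∞ (fun v : 𝔼 m => v i) u :=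
    (contDiff_piLp_apply (p := 2) (E := fun _ : Fin m => ℝ) (𝕜 := ℝ) (n := ∞) (i := i)).contDiffAt
  by_cases hi : (i : ℕ) < k
  · have : (fun v : 𝔼 m => handleInversion k v i) =
        fun v => v i * (Real.sqrt (1 - lamSq k v) / Real.sqrt (lamSq k v)) := by
      funext v; rw [handleInversion_apply, if_pos hi]
    rw [this]
    exact hc.mul (hs2.div hs1 hne1)
  · have : (fun v : 𝔼 m => handleInversion k v i) =
        fun v => v i * (Real.sqrt (lamSq k v) / Real.sqrt (1 - lamSq k v)) := by
      funext v; rw [handleInversion_apply, if_neg hi]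
    rw [this]
    exact hc.mul (hs1.div hs2 hne2)

end Model

/-! ### `α` on the closed ball and as a partial diffeomorphism `Dᵐ ∖ S ⇀ T` -/

section Pieces

variable (n k : ℕ)

/-- At points with `x_λ = 0` the (junk-extended) inversion vanishes. [folklore] -/
theorem handleInversion_of_lamSq_eq_zero {m : ℕ} {u : 𝔼 m} (h : lamSq k u = 0) :
    handleInversion k u = 0 := by
  ext i
  rw [handleInversion_apply, h]
  simp

/-- At points of the attaching sphere `|x_λ| = 1` the (junk-extended) inversion vanishes.
[folklore] -/
theorem handleInversion_of_lamSq_eq_one {m : ℕ} {u : 𝔼 m} (h : lamSq k u = 1) :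
    handleInversion k u = 0 := by
  ext i
  rw [handleInversion_apply, h]
  simp

/-- `α` maps the closed ball into itself (genuinely on `T ∖ S`, and by the junk value `0`
elsewhere). [cite: Kosinski1993, VI §6] -/
theorem handleInversion_coe_mem_closedBall (u : 𝔻 (n + 1)) :
    handleInversion k (u : 𝔼 (n + 1)) ∈ 𝔻 (n + 1) := by
  by_cases h0 : lamSq k (u : 𝔼 (n + 1)) = 0
  · rw [handleInversion_of_lamSq_eq_zero k h0]; simp
  by_cases h1 : lamSq k (u : 𝔼 (n + 1)) = 1
  · rw [handleInversion_of_lamSq_eq_one k h1]; simp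
  exact (handleInversion_mem h0 h1).1

/-- **`α` as a self-map of the closed ball `Dᵐ`** (the honest inversion on `T ∖ S`, the junk
value `0` on the belt disc and on the attaching sphere). [cite: Kosinski1993, VI (6.1)] -/
def handleInversionBall : 𝔻 (n + 1) → 𝔻 (n + 1) :=
  Set.codRestrict (fun u : 𝔻 (n + 1) => handleInversion k (u : 𝔼 (n + 1))) (𝔻 (n + 1))
    (handleInversion_coe_mem_closedBall n k)

/-- The underlying vector of `handleInversionBall`. [folklore] -/
@[simp] theorem coe_handleInversionBall (u : 𝔻 (n + 1)) :
    (handleInversionBall n k u : 𝔼 (n + 1)) = handleInversion k (u : 𝔼 (n + 1)) := rfl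

/-- **`α : Dᵐ → Dᵐ` is `C^∞` at every point of `T ∖ S`** for the manifold-with-boundary
structure of `Dᵐ` (smooth into `ℝᵐ` by `contDiffAt_handleInversion`, hence into `Dᵐ` by the
tree's `ContMDiffAt.codRestrict_closedBall`). [cite: Kosinski1993, VI (6.1)] -/
theorem contMDiffAt_handleInversionBall {u : 𝔻 (n + 1)} (h0 : lamSq k (u : 𝔼 (n + 1)) ≠ 0)
    (h1 : lamSq k (u : 𝔼 (n + 1)) ≠ 1) :
    ContMDiffAt (𝓡∂ (n + 1)) (𝓡∂ (n + 1)) ∞ (handleInversionBall n k) u := by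
  have h0' : 0 < lamSq k (u : 𝔼 (n + 1)) := lt_of_le_of_ne (lamSq_nonneg k _) (Ne.symm h0)
  have h1' : lamSq k (u : 𝔼 (n + 1)) < 1 :=
    lt_of_le_of_ne (lamSq_le_one (mem_closedBall_zero_iff.1 u.2)) h1
  have h : ContMDiffAt (𝓡∂ (n + 1)) 𝓘(ℝ, 𝔼 (n + 1)) ∞
      (fun v : 𝔻 (n + 1) => handleInversion k (v : 𝔼 (n + 1))) u :=
    (contDiffAt_handleInversion h0' h1').contMDiffAt.comp u (contMDiff_coe_closedBall u)
  exact h.codRestrict_closedBall _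

/-- `α` is continuous at every point of `T ∖ S`. [folklore] -/
theorem continuousAt_handleInversionBall {u : 𝔻 (n + 1)} (h0 : lamSq k (u : 𝔼 (n + 1)) ≠ 0)
    (h1 : lamSq k (u : 𝔼 (n + 1)) ≠ 1) : ContinuousAt (handleInversionBall n k) u :=
  (contMDiffAt_handleInversionBall n k h0 h1).continuousAt

/-- `|x_λ|²` on points of `Dᵐ ∖ S` is continuous. [folklore] -/
theorem continuous_lamSq_beltPiece :
    Continuous fun b : ↥(beltPiece n k) => lamSq k (((b : 𝔻 (n + 1)) : 𝔼 (n + 1))) :=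
  (continuous_lamSq k).comp (continuous_subtype_val.comp continuous_subtype_val)

/-- `|x_λ|²` on points of `T` is continuous. [folklore] -/
theorem continuous_lamSq_handleTube :
    Continuous fun y : ↥(handleTube n k) => lamSq k (((y : 𝔻 (n + 1)) : 𝔼 (n + 1))) :=
  (continuous_lamSq k).comp (continuous_subtype_val.comp continuous_subtype_val)

variable [Nonempty ↥(handleTube n k)]

/-- **Kosinski's inversion as a partial diffeomorphism `α : Dᵐ ∖ S ⇀ T`**: source
`{x_λ ≠ 0} = T ∖ S ⊆ Dᵐ ∖ S`, target `{|x_λ| ≠ 1} = T ∖ S ⊆ T`, inverse `α` (an involution,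
`handleInversion_handleInversion`); off the source the junk value is an arbitrary point of `T`.
[cite: Kosinski1993, VI (6.1)] -/
def handleInversionPH : OpenPartialHomeomorph ↥(beltPiece n k) ↥(handleTube n k) where
  toFun b := if hb : lamSq k (((b : 𝔻 (n + 1)) : 𝔼 (n + 1))) ≠ 0 then
      ⟨handleInversionBall n k b, (handleInversion_mem hb b.2).2.1⟩ else Classical.arbitrary _
  invFun y := ⟨handleInversionBall n k y, by
      rw [mem_beltPiece, coe_handleInversionBall]
      by_cases hy : lamSq k (((y : 𝔻 (n + 1)) : 𝔼 (n + 1))) = 1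
      · rw [handleInversion_of_lamSq_eq_one k hy]; simp [lamSq]
      · exact (handleInversion_mem y.2 hy).2.2⟩
  source := {b | lamSq k (((b : 𝔻 (n + 1)) : 𝔼 (n + 1))) ≠ 0}
  target := {y | lamSq k (((y : 𝔻 (n + 1)) : 𝔼 (n + 1))) ≠ 1}
  map_source' b hb := by
    have hb' : lamSq k (((b : 𝔻 (n + 1)) : 𝔼 (n + 1))) ≠ 0 := hb
    simp only [dif_pos hb', mem_setOf_eq, coe_handleInversionBall]
    exact (handleInversion_mem hb' b.2).2.2
  map_target' y hy := by
    have hy' : lamSq k (((y : 𝔻 (n + 1)) : 𝔼 (n + 1))) ≠ 1 := hy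
    show lamSq k (handleInversion k (((y : 𝔻 (n + 1)) : 𝔼 (n + 1)))) ≠ 0
    exact (handleInversion_mem y.2 hy').2.1
  left_inv' b hb := by
    have hb' : lamSq k (((b : 𝔻 (n + 1)) : 𝔼 (n + 1))) ≠ 0 := hb
    apply Subtype.ext; apply Subtype.ext
    simp only [dif_pos hb', coe_handleInversionBall]
    exact handleInversion_handleInversion (lt_of_le_of_ne (lamSq_nonneg k _) (Ne.symm hb'))
      (lt_of_le_of_ne (lamSq_le_one (mem_closedBall_zero_iff.1 (b : 𝔻 (n + 1)).2)) b.2)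
  right_inv' y hy := by
    have hy' : lamSq k (((y : 𝔻 (n + 1)) : 𝔼 (n + 1))) ≠ 1 := hy
    have h0 : lamSq k (handleInversion k (((y : 𝔻 (n + 1)) : 𝔼 (n + 1)))) ≠ 0 :=
      (handleInversion_mem y.2 hy').2.1
    apply Subtype.ext; apply Subtype.ext
    simp only [coe_handleInversionBall, dif_pos h0]
    exact handleInversion_handleInversion (lt_of_le_of_ne (lamSq_nonneg k _) (Ne.symm y.2))
      (lt_of_le_of_ne (lamSq_le_one (mem_closedBall_zero_iff.1 (y : 𝔻 (n + 1)).2)) hy')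
  open_source := isOpen_ne.preimage (continuous_lamSq_beltPiece n k)
  open_target := isOpen_ne.preimage (continuous_lamSq_handleTube n k)
  continuousOn_toFun := by
    intro b hb
    have hb' : lamSq k (((b : 𝔻 (n + 1)) : 𝔼 (n + 1))) ≠ 0 := hb
    rw [Topology.IsInducing.subtypeVal.continuousWithinAt_iff]
    have hc : ContinuousAt (fun b' : ↥(beltPiece n k) => handleInversionBall n k b') b :=
      (continuousAt_handleInversionBall n k hb' b.2).comp continuous_subtype_val.continuousAt
    refine (hc.continuousWithinAt.congr (fun b'' hb'' => ?_) ?_)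
    · have : lamSq k (((b'' : 𝔻 (n + 1)) : 𝔼 (n + 1))) ≠ 0 := hb''
      simp only [comp_apply, dif_pos this]
    · simp only [comp_apply, dif_pos hb']
  continuousOn_invFun := by
    intro y hy
    have hy' : lamSq k (((y : 𝔻 (n + 1)) : 𝔼 (n + 1))) ≠ 1 := hy
    rw [Topology.IsInducing.subtypeVal.continuousWithinAt_iff]
    exact ((continuousAt_handleInversionBall n k y.2 hy').comp
      continuous_subtype_val.continuousAt).continuousWithinAt

/-- The source of `α : Dᵐ ∖ S ⇀ T` is `{x_λ ≠ 0}`. [folklore] -/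
@[simp] theorem handleInversionPH_source :
    (handleInversionPH n k).source =
      {b : ↥(beltPiece n k) | lamSq k (((b : 𝔻 (n + 1)) : 𝔼 (n + 1))) ≠ 0} := rfl

/-- The target of `α : Dᵐ ∖ S ⇀ T` is `{|x_λ| ≠ 1}`. [folklore] -/
@[simp] theorem handleInversionPH_target :
    (handleInversionPH n k).target =
      {y : ↥(handleTube n k) | lamSq k (((y : 𝔻 (n + 1)) : 𝔼 (n + 1))) ≠ 1} := rfl

/-- On its source, `α : Dᵐ ∖ S ⇀ T` is `handleInversionPt`. [folklore] -/
theorem handleInversionPH_apply {b : ↥(beltPiece n k)} (hb : lamSq k (((b : 𝔻 (n + 1)) : 𝔼 (n + 1))) ≠ 0) :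
    handleInversionPH n k b = handleInversionPt (b : 𝔻 (n + 1)) hb b.2 := by
  apply Subtype.ext; apply Subtype.ext
  show ((((handleInversionPH n k).toFun b) : 𝔻 (n + 1)) : 𝔼 (n + 1)) = _
  simp only [handleInversionPH, dif_pos hb, coe_handleInversionBall, coe_coe_handleInversionPt]

/-- The underlying vector of `α b` for `b` in the source. [folklore] -/
theorem coe_coe_handleInversionPH {b : ↥(beltPiece n k)}
    (hb : lamSq k (((b : 𝔻 (n + 1)) : 𝔼 (n + 1))) ≠ 0) :
    (((handleInversionPH n k b : ↥(handleTube n k)) : 𝔻 (n + 1)) : 𝔼 (n + 1)) =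
      handleInversion k (((b : 𝔻 (n + 1)) : 𝔼 (n + 1))) := by
  rw [handleInversionPH_apply n k hb, coe_coe_handleInversionPt]

/-- The underlying vector of `α⁻¹ y = α y`. [folklore] -/
@[simp] theorem coe_coe_handleInversionPH_symm (y : ↥(handleTube n k)) :
    ((((handleInversionPH n k).symm y : ↥(beltPiece n k)) : 𝔻 (n + 1)) : 𝔼 (n + 1)) =
      handleInversion k (((y : 𝔻 (n + 1)) : 𝔼 (n + 1))) := rfl

/-- **`α : Dᵐ ∖ S ⇀ T` is `C^∞` on its source.** [cite: Kosinski1993, VI (6.1)] -/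
theorem contMDiffOn_handleInversionPH :
    ContMDiffOn (𝓡∂ (n + 1)) (𝓡∂ (n + 1)) ∞ (handleInversionPH n k) (handleInversionPH n k).source := by
  intro b hb
  have hb' : lamSq k (((b : 𝔻 (n + 1)) : 𝔼 (n + 1))) ≠ 0 := hb
  refine ContMDiffAt.contMDiffWithinAt ?_
  rw [← ContMDiffAt.subtypeVal_comp_iff]
  have hG : ContMDiffAt (𝓡∂ (n + 1)) (𝓡∂ (n + 1)) ∞
      (fun b' : ↥(beltPiece n k) => handleInversionBall n k b') b :=
    (contMDiffAt_handleInversionBall n k hb' b.2).comp b (contMDiff_subtype_val b)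
  refine hG.congr_of_eventuallyEq ?_
  filter_upwards [(handleInversionPH n k).open_source.mem_nhds hb] with b'' hb''
  have : lamSq k (((b'' : 𝔻 (n + 1)) : 𝔼 (n + 1))) ≠ 0 := hb''
  apply Subtype.ext
  simp only [comp_apply, coe_handleInversionBall]
  exact coe_coe_handleInversionPH n k this

/-- **`α⁻¹ = α : T ∖ S → Dᵐ ∖ S` is `C^∞` on the target.** [cite: Kosinski1993, VI (6.1)] -/
theorem contMDiffOn_handleInversionPH_symm :
    ContMDiffOn (𝓡∂ (n + 1)) (𝓡∂ (n + 1)) ∞ (handleInversionPH n k).symm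
      (handleInversionPH n k).target := by
  intro y hy
  have hy' : lamSq k (((y : 𝔻 (n + 1)) : 𝔼 (n + 1))) ≠ 1 := hy
  refine ContMDiffAt.contMDiffWithinAt ?_
  rw [← ContMDiffAt.subtypeVal_comp_iff]
  exact (contMDiffAt_handleInversionBall n k y.2 hy').comp y (contMDiff_subtype_val y)

end Pieces

end Literature.Topology.FourManifolds

end
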